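import Summits.BirchSwinnertonDyer.BirchSwinnertonDyer.Theorems.ByReductionTypeAtTwoMultTowerNS2LayerZeroCoinvFinite
import HarnessLib

/-!
# Route `ByReductionTypeAtTwo`, crux `MultUpperHalfAtTwo` (item stmt-BirchSwinnertonDyer-19922), TOWER road, NON-SPLIT rows:
# the layer-`0` order of the local tower kernel at a non-split `2`, part 9 — the ODD-EXPONENT `4`-torsion witness and the
# counts `2 ≤ #(M_∞/(g−1)M_∞)[2^∞]`, `4 ≤ #(M_∞/(g−1)M_∞)[2^∞]`

HONEST FRAMING (cell `bsd-2adic`, run/shared/lean/pub/bsd-2adic/, seat `bsd-2adic-tower-1` GEN 30, HUMAN RULINGS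
D-0036 / D-0054 / D-0074): TOOL theorems only (no definition, no named fact, no `sorry`); closes nothing by itself;
nothing booked; BSD is not proved by any of this. Ninth brick of the layer-`0` count `#𝒦_{v,0}[2^∞] = 2·c₂^{(2)}` at a
non-split multiplicative `2` (R. Greenberg, LNM 1716, §3 p. 93 «`|ker(r_v)| ∼ 2c_v`», §4 p. 113 «If p = 2, then
`|ker(r_v)| = 2c_v^{(p)}`»): the LOWER bounds on the coinvariants of the twisted Tate module `T` (`M_∞ = Ψ(T)`, BRICK 18;
`B = Q^ℤ·(g−1)T` the trivial classes).

* `exists_pow_four_eq_sq_mul_coboundary` — **the witness.** From `x₁ ∈ T` of exponent ONE (`τ₀x₁·x₁ = Q`) and an element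
  `f` of the second layer `F'_2 = K̄^{H_2 ∩ Stab t}` with RELATIVE NORM `f·gf·g²f·g³f = x₁/τ₀x₁` (part 7,
  `exists_prod_smul_eq_of_norm_mem_range_norm_layer`), the element `y = x₁·τ₀f/f ∈ T` has exponent `1` and
  `y⁴ = Q²·(gz/z)` with `z = τ₀z'/z' ∈ T`, `z' = (f³(gf)²(g²f))⁻¹` (so `gz'/z' = f⁴/N(f)`): an ODD-exponent class killed
  by `4` — pure algebra with the commutation `τ₀g = gτ₀` on `K̄^{H_2 ∩ Stab t}`;
* `two_le_natCard_primaryComponent_of_odd` — an odd-exponent `y ∈ T` with `y^{2^k} ∈ B` gives `[Ψy] ≠ 0` in the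
  `2`-primary component (elements of `B` have even exponent), so `2 ≤ #(M_∞/(g−1)M_∞)[2^∞]`;
* `four_le_natCard_primaryComponent_of_odd_of_neg_one` — if moreover `−1 ∉ B` (part 1
  `neg_one_ne_zpow_mul_coboundary_of_even`, `ord₂ q_E` even) then `0, [Ψ(−1)], [Ψy], [Ψ(−y)]` are pairwise distinct
  `2`-power-torsion classes: `4 ≤ #(M_∞/(g−1)M_∞)[2^∞]`.

References: R. Greenberg, LNM 1716 (1999), §3 p. 93, §4 pp. 112–113; J. Silverman, GTM 151, V.3–V.5.
-/

set_option autoImplicit false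
-- the Theorems namespace of this sub repeats the summit name by design (D-0017 nested layout: Summit.<S>.<Sub>)
set_option linter.dupNamespace false

noncomputable section

open scoped Classical IntermediateField

namespace Summit.BirchSwinnertonDyer.BirchSwinnertonDyer.Theorems.MultTowerNS2LayerZero

open NumberField IsDedekindDomain Field WeierstrassCurve PadicInt Literature.NumberTheory.EllipticCurves
  Literature.NumberTheory.EllipticCurves.ResKernel Literature.NumberTheory.GaloisRepresentations
  Summit.BirchSwinnertonDyer.BirchSwinnertonDyer.Theorems.MultTowerNS2

variable {κ : ZpExtension ℚ 2}

/-! ### The odd-exponent `4`-torsion witness -/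

/-- **The witness `y = x₁·τ₀f/f`: exponent `1`, `y⁴ = Q²·(gz/z)`.** Abstract setting: `σt = ±t` for all `σ`; normal
subgroups `Nᵢ ≤ N₂` of `Γ_{ℚ_v}` (`H_∞ ≤ H_2`), a flip `τ₀ ∈ Nᵢ`, `g` fixing `t` with `g⁴f = f`; `x₁ ≠ 0` fixed by
`Nᵢ ∩ Stab(t)` with `τ₀x₁·x₁ = Q`; `f ≠ 0` fixed by `N₂ ∩ Stab(t)` with `∏_{i<4} gⁱf = x₁/τ₀x₁`. Then there are `y, z ≠ 0`
fixed by `Nᵢ ∩ Stab(t)` with `τ₀y·y = Q¹`, `τ₀z·z = Q⁰` and `y^{2^2} = Q²·(gz/z)` (`z = τ₀z'/z'`, `z' = (f³(gf)²(g²f))⁻¹`,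
`gz'/z' = f⁴/(f·gf·g²f·g³f)`). [cite: GreenbergLNM1716, §3 p. 93 and §4 p. 113] -/
theorem exists_pow_four_eq_sq_mul_coboundary (v : HeightOneSpectrum (𝓞 ℚ))
    {t Q x₁ f : AlgebraicClosure (v.adicCompletion ℚ)} {τ₀ g : absoluteGaloisGroup (v.adicCompletion ℚ)}
    (ht : ∀ σ : absoluteGaloisGroup (v.adicCompletion ℚ), σ • t = t ∨ σ • t = -t)
    {N₂ Ni : Subgroup (absoluteGaloisGroup (v.adicCompletion ℚ))} [N₂.Normal] [Ni.Normal] (hle : Ni ≤ N₂)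
    (hτ₀ : τ₀ ∈ Ni) (hτ₀t : τ₀ • t = -t) (hgt : g • t = t) (hx0 : x₁ ≠ 0)
    (hxL : ∀ h ∈ Ni, h • t = t → h • x₁ = x₁) (hxQ : τ₀ • x₁ * x₁ = Q) (hf0 : f ≠ 0)
    (hfL : ∀ h ∈ N₂, h • t = t → h • f = f) (hg4 : (g ^ 4) • f = f)
    (hNf : (∏ i ∈ Finset.range (2 ^ 2), (g ^ i) • f) = x₁ / τ₀ • x₁) :
    ∃ y z : AlgebraicClosure (v.adicCompletion ℚ), y ≠ 0 ∧ (∀ h ∈ Ni, h • t = t → h • y = y) ∧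
      τ₀ • y * y = Q ^ (1 : ℤ) ∧ z ≠ 0 ∧ (∀ h ∈ Ni, h • t = t → h • z = z) ∧ τ₀ • z * z = Q ^ (0 : ℤ) ∧
      y ^ 2 ^ 2 = Q ^ (2 : ℤ) * (g • z / z) := by
  have hτ₀₂ : τ₀ ∈ N₂ := hle hτ₀
  -- the conjugates `b = gf`, `c = g²f`, `d = g³f` and the flips `A = τ₀f`, `Aᵢ = τ₀(gⁱf)`
  set b : AlgebraicClosure (v.adicCompletion ℚ) := g • f with hb
  set c : AlgebraicClosure (v.adicCompletion ℚ) := (g ^ 2) • f with hc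
  set dd : AlgebraicClosure (v.adicCompletion ℚ) := (g ^ 3) • f with hdd
  set A : AlgebraicClosure (v.adicCompletion ℚ) := τ₀ • f with hA
  set A₁ : AlgebraicClosure (v.adicCompletion ℚ) := τ₀ • b with hA₁
  set A₂ : AlgebraicClosure (v.adicCompletion ℚ) := τ₀ • c with hA₂
  set A₃ : AlgebraicClosure (v.adicCompletion ℚ) := τ₀ • dd with hA₃
  set X : AlgebraicClosure (v.adicCompletion ℚ) := τ₀ • x₁ with hX
  have hbL : ∀ h ∈ N₂, h • t = t → h • b = b := smul_mem_of_forall_mem_smul_eq ht N₂ hfL g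
  have hcL : ∀ h ∈ N₂, h • t = t → h • c = c := smul_mem_of_forall_mem_smul_eq ht N₂ hfL (g ^ 2)
  have hdL : ∀ h ∈ N₂, h • t = t → h • dd = dd := smul_mem_of_forall_mem_smul_eq ht N₂ hfL (g ^ 3)
  have hb0 : b ≠ 0 := (smul_ne_zero_iff_ne g).mpr hf0
  have hc0 : c ≠ 0 := (smul_ne_zero_iff_ne (g ^ 2)).mpr hf0
  have hd0 : dd ≠ 0 := (smul_ne_zero_iff_ne (g ^ 3)).mpr hf0
  have hA0 : A ≠ 0 := (smul_ne_zero_iff_ne τ₀).mpr hf0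
  have hA10 : A₁ ≠ 0 := (smul_ne_zero_iff_ne τ₀).mpr hb0
  have hA20 : A₂ ≠ 0 := (smul_ne_zero_iff_ne τ₀).mpr hc0
  have hA30 : A₃ ≠ 0 := (smul_ne_zero_iff_ne τ₀).mpr hd0
  have hX0 : X ≠ 0 := (smul_ne_zero_iff_ne τ₀).mpr hx0
  -- `g` on the conjugates, `τ₀²`, and the two commutations
  have hgb : g • b = c := by rw [hb, hc, smul_smul, ← pow_two]
  have hgc : g • c = dd := by rw [hc, hdd, smul_smul, ← pow_succ']
  have hgd : g • dd = f := by rw [hdd, smul_smul, ← pow_succ', hg4]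
  have hττf : τ₀ • A = f := flip_smul_flip_smul hτ₀₂ hτ₀t hfL
  have hττx : τ₀ • X = x₁ := flip_smul_flip_smul hτ₀ hτ₀t hxL
  -- (R1) `f b c d = x₁ / X`, (R2) `A A₁ A₂ A₃ = X / x₁`
  have hR1 : f * b * c * dd = x₁ / X := by
    have h := hNf
    simp only [show (2 : ℕ) ^ 2 = 4 from rfl, Finset.prod_range_succ, Finset.prod_range_zero, one_mul, pow_zero,
      one_smul, pow_one] at h
    exact h
  have hR2 : A * A₁ * A₂ * A₃ = X / x₁ := by
    have h := congrArg (fun e ↦ τ₀ • e) hR1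
    simp only [smul_mul', smul_div₀'] at h
    rw [hττx] at h
    exact h
  have hdd' : dd = x₁ / (X * (f * b * c)) := by
    rw [eq_div_iff (mul_ne_zero hX0 (mul_ne_zero (mul_ne_zero hf0 hb0) hc0))]
    rw [eq_div_iff hX0] at hR1
    linear_combination hR1
  have hA3' : A₃ = X / (x₁ * (A * A₁ * A₂)) := by
    rw [eq_div_iff (mul_ne_zero hx0 (mul_ne_zero (mul_ne_zero hA0 hA10) hA20))]
    rw [eq_div_iff hx0] at hR2
    linear_combination hR2
  -- the elements
  set z' : AlgebraicClosure (v.adicCompletion ℚ) := (f ^ 3 * b ^ 2 * c)⁻¹ with hz'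
  have hz'0 : z' ≠ 0 := inv_ne_zero (mul_ne_zero (mul_ne_zero (pow_ne_zero _ hf0) (pow_ne_zero _ hb0)) hc0)
  have hz'L : ∀ h ∈ N₂, h • t = t → h • z' = z' := fun h hh hht ↦ by
    rw [hz', smul_inv'', smul_mul', smul_mul', smul_pow', smul_pow', hfL h hh hht, hbL h hh hht, hcL h hh hht]
  have hgz' : g • z' = (b ^ 3 * c ^ 2 * dd)⁻¹ := by
    rw [hz', smul_inv'', smul_mul', smul_mul', smul_pow', smul_pow', ← hb, hgb, hgc]
  have hτz' : τ₀ • z' = (A ^ 3 * A₁ ^ 2 * A₂)⁻¹ := by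
    rw [hz', smul_inv'', smul_mul', smul_mul', smul_pow', smul_pow']
  have hτgz' : τ₀ • (g • z') = (A₁ ^ 3 * A₂ ^ 2 * A₃)⁻¹ := by
    rw [hgz', smul_inv'', smul_mul', smul_mul', smul_pow', smul_pow']
  have hτz'0 : τ₀ • z' ≠ 0 := (smul_ne_zero_iff_ne τ₀).mpr hz'0
  have hgz'0 : g • z' ≠ 0 := (smul_ne_zero_iff_ne g).mpr hz'0
  refine ⟨x₁ * A / f, τ₀ • z' / z', div_ne_zero (mul_ne_zero hx0 hA0) hf0, fun h hh hht ↦ ?_, ?_,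
    div_ne_zero hτz'0 hz'0, fun h hh hht ↦ ?_, ?_, ?_⟩
  · -- `y` is fixed by `Nᵢ ∩ Stab t`
    rw [smul_div₀', smul_mul', hxL h hh hht, hfL h (hle hh) hht, hA,
      ← flip_smul_smul_comm ht hτ₀₂ hτ₀t hht hfL, hfL h (hle hh) hht]
  · -- exponent of `y`
    rw [smul_div₀', smul_mul', hττf, zpow_one, ← hxQ, ← hX, ← hA]
    field_simp
  · -- `z` is fixed by `Nᵢ ∩ Stab t`
    rw [smul_div₀', hz'L h (hle hh) hht, ← flip_smul_smul_comm ht hτ₀₂ hτ₀t hht hz'L, hz'L h (hle hh) hht]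
  · -- exponent of `z`
    rw [smul_div₀', flip_smul_flip_smul hτ₀₂ hτ₀t hz'L, zpow_zero]
    field_simp
  · -- `y⁴ = Q² (g z / z)`
    have hgz : g • (τ₀ • z' / z') = τ₀ • (g • z') / (g • z') := by
      rw [smul_div₀', ← flip_smul_smul_comm ht hτ₀₂ hτ₀t hgt hz'L]
    rw [hgz, hτgz', hτz', hgz', hz', inv_div_inv, inv_div_inv, ← hxQ, hdd', hA3',
      show (2 : ℕ) ^ 2 = 4 from rfl]
    field_simp

/-! ### Counting `2`-power-torsion classes -/

section Count

variable (v : HeightOneSpectrum (𝓞 ℚ)) {W : WeierstrassCurve ℚ}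
  {Ψ : Additive (AlgebraicClosure (v.adicCompletion ℚ))ˣ →+ localPoints W (v.adicCompletion ℚ)}
  {t Q : AlgebraicClosure (v.adicCompletion ℚ)} {τ₀ g : absoluteGaloisGroup (v.adicCompletion ℚ)}

/-- **An odd-exponent `2`-power-torsion class is non-trivial: `2 ≤ #(M_∞/(g−1)M_∞)[2^∞]`.** Abstract setting of BRICK 18;
`y ≠ 0` fixed by `H_∞ ∩ Stab(t)` with `τ₀y·y = Q^a`, `a` ODD, and `y^{2^k} = Qʲ·(gz/z)` for some `z ∈ T`. Then `[Ψy]`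
is a non-zero element of the (finite) `2`-primary component: it is killed by `2^k`, and `[Ψy] = 0` would put `y` in
`B = Q^ℤ·(g−1)T`, whose elements have even exponent. [cite: GreenbergLNM1716, §3 p. 93 and §4 p. 113] -/
theorem two_le_natCard_primaryComponent_of_odd (hsurj : Function.Surjective Ψ)
    (hker : ∀ u : (AlgebraicClosure (v.adicCompletion ℚ))ˣ, Ψ (Additive.ofMul u) = 0 ↔
      ∃ j : ℤ, (u : AlgebraicClosure (v.adicCompletion ℚ)) = Q ^ j)
    (hequiv' : ∀ (σ : absoluteGaloisGroup (v.adicCompletion ℚ)) (w w' : (AlgebraicClosure (v.adicCompletion ℚ))ˣ),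
      (w' : AlgebraicClosure (v.adicCompletion ℚ)) = σ • (w : AlgebraicClosure (v.adicCompletion ℚ)) →
        σ • Ψ (Additive.ofMul w) = (if σ • t = t then (1 : ℤ) else -1) • Ψ (Additive.ofMul w'))
    (ht : ∀ σ : absoluteGaloisGroup (v.adicCompletion ℚ), σ • t = t ∨ σ • t = -t) (hne : -t ≠ t) (hgt : g • t = t)
    (hτ₀ : τ₀ ∈ localSubgroup κ.kerSubgroup (v.adicCompletion ℚ)) (hτ₀t : τ₀ • t = -t)
    (hQfix : ∀ σ : absoluteGaloisGroup (v.adicCompletion ℚ), σ • Q = Q) (hQ0 : Q ≠ 0)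
    (hQtor : ∀ j : ℤ, Q ^ j = 1 → j = 0)
    {y z : AlgebraicClosure (v.adicCompletion ℚ)} (hy0 : y ≠ 0)
    (hyL : ∀ h ∈ localSubgroup κ.kerSubgroup (v.adicCompletion ℚ), h • t = t → h • y = y)
    {a : ℤ} (hya : τ₀ • y * y = Q ^ a) (ha : Odd a) (hz0 : z ≠ 0)
    (hzL : ∀ h ∈ localSubgroup κ.kerSubgroup (v.adicCompletion ℚ), h • t = t → h • z = z)
    {jz : ℤ} (hzj : τ₀ • z * z = Q ^ jz) {k : ℕ} {j : ℤ} (hyk : y ^ 2 ^ k = Q ^ j * (g • z / z))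
    [Finite (AddCommGroup.primaryComponent
      (FixedPoints.addSubgroup (localSubgroup κ.kerSubgroup (v.adicCompletion ℚ)) (localPoints W (v.adicCompletion ℚ)) ⧸
        (subOne (localSubgroup κ.kerSubgroup (v.adicCompletion ℚ)) (localPoints W (v.adicCompletion ℚ)) g).range) 2)] :
    2 ≤ Nat.card (AddCommGroup.primaryComponent
      (FixedPoints.addSubgroup (localSubgroup κ.kerSubgroup (v.adicCompletion ℚ)) (localPoints W (v.adicCompletion ℚ)) ⧸
        (subOne (localSubgroup κ.kerSubgroup (v.adicCompletion ℚ)) (localPoints W (v.adicCompletion ℚ)) g).range) 2) := by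
  have hyu : (Units.mk0 y hy0 : AlgebraicClosure (v.adicCompletion ℚ)) = y := Units.val_mk0 _
  have hmY : ∀ h ∈ localSubgroup κ.kerSubgroup (v.adicCompletion ℚ),
      h • Ψ (Additive.ofMul (Units.mk0 y hy0)) = Ψ (Additive.ofMul (Units.mk0 y hy0)) :=
    apply_mem_fixedPoints (κ := κ) v hker hequiv' ht hne hτ₀ hτ₀t (x := Units.mk0 y hy0)
      (fun h hh hht ↦ by rw [hyu]; exact hyL h hh hht) (a := a) (by rw [hyu]; exact hya)
  let mY : FixedPoints.addSubgroup (localSubgroup κ.kerSubgroup (v.adicCompletion ℚ)) (localPoints W (v.adicCompletion ℚ)) :=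
    ⟨Ψ (Additive.ofMul (Units.mk0 y hy0)), fun h ↦ hmY h h.2⟩
  have htor := nsmul_mk_eq_zero_of_pow_eq_zpow_mul_coboundary (κ := κ) v hker hequiv' ht hne hgt hτ₀ hτ₀t
    (u := Units.mk0 y hy0) (m := mY) rfl hz0 hzL hzj (k := k) (j := j) (by rw [hyu]; exact hyk)
  let c1 : AddCommGroup.primaryComponent
      (FixedPoints.addSubgroup (localSubgroup κ.kerSubgroup (v.adicCompletion ℚ)) (localPoints W (v.adicCompletion ℚ)) ⧸
        (subOne (localSubgroup κ.kerSubgroup (v.adicCompletion ℚ)) (localPoints W (v.adicCompletion ℚ)) g).range) 2 :=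
    ⟨(mY : _ ⧸ (subOne (localSubgroup κ.kerSubgroup (v.adicCompletion ℚ)) (localPoints W (v.adicCompletion ℚ)) g).range),
      (AddCommGroup.mem_primaryComponent).mpr ⟨k, htor⟩⟩
  have c0val : ((0 : AddCommGroup.primaryComponent
      (FixedPoints.addSubgroup (localSubgroup κ.kerSubgroup (v.adicCompletion ℚ)) (localPoints W (v.adicCompletion ℚ)) ⧸
        (subOne (localSubgroup κ.kerSubgroup (v.adicCompletion ℚ)) (localPoints W (v.adicCompletion ℚ)) g).range) 2) :
      _ ⧸ (subOne (localSubgroup κ.kerSubgroup (v.adicCompletion ℚ)) (localPoints W (v.adicCompletion ℚ)) g).range) =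
      ((0 : FixedPoints.addSubgroup (localSubgroup κ.kerSubgroup (v.adicCompletion ℚ))
          (localPoints W (v.adicCompletion ℚ))) : _ ⧸ _) := by
    simp
  have hne1 : c1 ≠ 0 := by
    intro h
    have h' := (congrArg Subtype.val h).trans c0val
    obtain ⟨j', w, hw0, hwL, ⟨jw, hwj⟩, hrel⟩ := exists_div_eq_zpow_mul_coboundary_of_mk_eq_mk (κ := κ) v hsurj hker
      hequiv' hQfix hQ0 hQtor hne hgt hτ₀ hτ₀t (u₁ := Units.mk0 y hy0) (u₂ := 1) (m₁ := mY) (m₂ := 0) rfl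
      (by rw [ofMul_one, map_zero]; rfl) h'
    rw [hyu, Units.val_one, div_one] at hrel
    have h2 := eq_two_mul_of_eq_zpow_mul_coboundary (κ := κ) v ht hgt hτ₀ hτ₀t hQfix hQ0 hQtor hya hw0 hwL hwj hrel
    exact (Int.not_even_iff_odd.mpr ha) ⟨j', by rw [h2]; ring⟩
  have h1 : 1 < Nat.card (AddCommGroup.primaryComponent
      (FixedPoints.addSubgroup (localSubgroup κ.kerSubgroup (v.adicCompletion ℚ)) (localPoints W (v.adicCompletion ℚ)) ⧸
        (subOne (localSubgroup κ.kerSubgroup (v.adicCompletion ℚ)) (localPoints W (v.adicCompletion ℚ)) g).range) 2) :=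
    Finite.one_lt_card_iff_nontrivial.mpr ⟨⟨c1, 0, hne1⟩⟩
  omega

/-- **`4 ≤ #(M_∞/(g−1)M_∞)[2^∞]` when `−1 ∉ B`.** Same setting; assume moreover that `−1 ≠ Qʲ·(gw/w)` for every `w ∈ T`
and `j` (part 1 `neg_one_ne_zpow_mul_coboundary_of_even`: `ord₂ q_E` even). Then `0`, `[Ψ(−1)]`, `[Ψy]`, `[Ψ(−y)]` are four
pairwise distinct `2`-power-torsion classes (the quotients `±y^{±1}` have odd exponent, `−1 ∉ B`).
[cite: GreenbergLNM1716, §3 p. 93 and §4 p. 113] -/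
theorem four_le_natCard_primaryComponent_of_odd_of_neg_one (hsurj : Function.Surjective Ψ)
    (hker : ∀ u : (AlgebraicClosure (v.adicCompletion ℚ))ˣ, Ψ (Additive.ofMul u) = 0 ↔
      ∃ j : ℤ, (u : AlgebraicClosure (v.adicCompletion ℚ)) = Q ^ j)
    (hequiv' : ∀ (σ : absoluteGaloisGroup (v.adicCompletion ℚ)) (w w' : (AlgebraicClosure (v.adicCompletion ℚ))ˣ),
      (w' : AlgebraicClosure (v.adicCompletion ℚ)) = σ • (w : AlgebraicClosure (v.adicCompletion ℚ)) →
        σ • Ψ (Additive.ofMul w) = (if σ • t = t then (1 : ℤ) else -1) • Ψ (Additive.ofMul w'))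
    (ht : ∀ σ : absoluteGaloisGroup (v.adicCompletion ℚ), σ • t = t ∨ σ • t = -t) (hne : -t ≠ t) (hgt : g • t = t)
    (hτ₀ : τ₀ ∈ localSubgroup κ.kerSubgroup (v.adicCompletion ℚ)) (hτ₀t : τ₀ • t = -t)
    (hQfix : ∀ σ : absoluteGaloisGroup (v.adicCompletion ℚ), σ • Q = Q) (hQ0 : Q ≠ 0)
    (hQtor : ∀ j : ℤ, Q ^ j = 1 → j = 0)
    (hneg : ∀ (w : AlgebraicClosure (v.adicCompletion ℚ)) (aw jw : ℤ), w ≠ 0 →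
      (∀ h ∈ localSubgroup κ.kerSubgroup (v.adicCompletion ℚ), h • t = t → h • w = w) →
      τ₀ • w * w = Q ^ aw → -1 ≠ Q ^ jw * (g • w / w))
    {y z : AlgebraicClosure (v.adicCompletion ℚ)} (hy0 : y ≠ 0)
    (hyL : ∀ h ∈ localSubgroup κ.kerSubgroup (v.adicCompletion ℚ), h • t = t → h • y = y)
    {a : ℤ} (hya : τ₀ • y * y = Q ^ a) (ha : Odd a) (hz0 : z ≠ 0)
    (hzL : ∀ h ∈ localSubgroup κ.kerSubgroup (v.adicCompletion ℚ), h • t = t → h • z = z)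
    {jz : ℤ} (hzj : τ₀ • z * z = Q ^ jz) {k : ℕ} {j : ℤ} (hyk : y ^ 2 ^ k = Q ^ j * (g • z / z))
    [Finite (AddCommGroup.primaryComponent
      (FixedPoints.addSubgroup (localSubgroup κ.kerSubgroup (v.adicCompletion ℚ)) (localPoints W (v.adicCompletion ℚ)) ⧸
        (subOne (localSubgroup κ.kerSubgroup (v.adicCompletion ℚ)) (localPoints W (v.adicCompletion ℚ)) g).range) 2)] :
    4 ≤ Nat.card (AddCommGroup.primaryComponent
      (FixedPoints.addSubgroup (localSubgroup κ.kerSubgroup (v.adicCompletion ℚ)) (localPoints W (v.adicCompletion ℚ)) ⧸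
        (subOne (localSubgroup κ.kerSubgroup (v.adicCompletion ℚ)) (localPoints W (v.adicCompletion ℚ)) g).range) 2) := by
  -- notation
  set P := localPoints W (v.adicCompletion ℚ) with hP
  set Hi := localSubgroup κ.kerSubgroup (v.adicCompletion ℚ) with hHi
  haveI : CharZero (AlgebraicClosure (v.adicCompletion ℚ)) :=
    charZero_of_injective_algebraMap (algebraMap ℚ (AlgebraicClosure (v.adicCompletion ℚ))).injective
  have hm10 : (-1 : AlgebraicClosure (v.adicCompletion ℚ)) ≠ 0 := neg_ne_zero.mpr one_ne_zero
  have hmy0 : -y ≠ 0 := neg_ne_zero.mpr hy0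
  have hτneg : ∀ e : AlgebraicClosure (v.adicCompletion ℚ), τ₀ • (-e) = -(τ₀ • e) := fun e ↦ smul_neg τ₀ e
  have hτone : τ₀ • (1 : AlgebraicClosure (v.adicCompletion ℚ)) = 1 := smul_one τ₀
  -- the units `1, -1, y, -y` and their `T`-data
  have hm1L : ∀ h ∈ Hi, h • t = t → h • (-1 : AlgebraicClosure (v.adicCompletion ℚ)) = -1 := fun h _ _ ↦ by
    rw [smul_neg, smul_one]
  have hm1a : τ₀ • (-1 : AlgebraicClosure (v.adicCompletion ℚ)) * (-1) = Q ^ (0 : ℤ) := by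
    rw [hτneg, hτone, zpow_zero]; ring
  have hmyL : ∀ h ∈ Hi, h • t = t → h • (-y) = -y := fun h hh hht ↦ by rw [smul_neg, hyL h hh hht]
  have hmya : τ₀ • (-y) * (-y) = Q ^ a := by rw [hτneg, neg_mul_neg, hya]
  -- torsion data: `(±y)^{2^{k+1}} = Q^{2j} · g(z²)/z²`, `(-1)^2 = Q⁰ · g1/1`
  have hz2L : ∀ h ∈ Hi, h • t = t → h • (z ^ 2) = z ^ 2 := fun h hh hht ↦ by rw [smul_pow', hzL h hh hht]
  have hz2j : τ₀ • (z ^ 2) * z ^ 2 = Q ^ (2 * jz) := by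
    rw [smul_pow', ← mul_pow, hzj, ← zpow_natCast, ← zpow_mul]; ring_nf
  have hyk2 : y ^ 2 ^ (k + 1) = Q ^ (2 * j) * (g • (z ^ 2) / z ^ 2) := by
    rw [pow_succ, pow_mul, hyk, smul_pow', mul_pow, div_pow, ← zpow_natCast (Q ^ j), ← zpow_mul]; ring_nf
  have hmyk2 : (-y) ^ 2 ^ (k + 1) = Q ^ (2 * j) * (g • (z ^ 2) / z ^ 2) := by
    rw [← hyk2]; exact Even.neg_pow ⟨2 ^ k, by ring⟩ y
  have hone1 : (-1 : AlgebraicClosure (v.adicCompletion ℚ)) ^ 2 ^ 1 = Q ^ (0 : ℤ) * (g • (1 : AlgebraicClosure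
      (v.adicCompletion ℚ)) / 1) := by rw [smul_one, zpow_zero]; norm_num
  have h1L : ∀ h ∈ Hi, h • t = t → h • (1 : AlgebraicClosure (v.adicCompletion ℚ)) = 1 := fun h _ _ ↦ smul_one h
  have h1j : τ₀ • (1 : AlgebraicClosure (v.adicCompletion ℚ)) * 1 = Q ^ (0 : ℤ) := by rw [hτone, zpow_zero, mul_one]
  -- classes
  have mkM : ∀ (u : (AlgebraicClosure (v.adicCompletion ℚ))ˣ) (au : ℤ),
      (∀ h ∈ Hi, h • t = t → h • (u : AlgebraicClosure (v.adicCompletion ℚ)) = u) →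
      τ₀ • (u : AlgebraicClosure (v.adicCompletion ℚ)) * u = Q ^ au →
      ∀ h ∈ Hi, h • Ψ (Additive.ofMul u) = Ψ (Additive.ofMul u) := fun u au huL hua ↦
    apply_mem_fixedPoints (κ := κ) v hker hequiv' ht hne hτ₀ hτ₀t huL hua
  let uY : (AlgebraicClosure (v.adicCompletion ℚ))ˣ := Units.mk0 y hy0
  let uMY : (AlgebraicClosure (v.adicCompletion ℚ))ˣ := Units.mk0 (-y) hmy0
  let uM1 : (AlgebraicClosure (v.adicCompletion ℚ))ˣ := Units.mk0 (-1) hm10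
  have huY : (uY : AlgebraicClosure (v.adicCompletion ℚ)) = y := Units.val_mk0 _
  have huMY : (uMY : AlgebraicClosure (v.adicCompletion ℚ)) = -y := Units.val_mk0 _
  have huM1 : (uM1 : AlgebraicClosure (v.adicCompletion ℚ)) = -1 := Units.val_mk0 _
  let mY : FixedPoints.addSubgroup Hi P :=
    ⟨Ψ (Additive.ofMul uY), fun h ↦ mkM uY a (by rw [huY]; exact hyL) (by rw [huY]; exact hya) h h.2⟩
  let mMY : FixedPoints.addSubgroup Hi P :=
    ⟨Ψ (Additive.ofMul uMY), fun h ↦ mkM uMY a (by rw [huMY]; exact hmyL) (by rw [huMY]; exact hmya) h h.2⟩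
  let mM1 : FixedPoints.addSubgroup Hi P :=
    ⟨Ψ (Additive.ofMul uM1), fun h ↦ mkM uM1 0 (by rw [huM1]; exact hm1L) (by rw [huM1]; exact hm1a) h h.2⟩
  set D := (subOne Hi P g).range with hD
  let cY : AddCommGroup.primaryComponent (FixedPoints.addSubgroup Hi P ⧸ D) 2 :=
    ⟨mY, (AddCommGroup.mem_primaryComponent).mpr ⟨k + 1, nsmul_mk_eq_zero_of_pow_eq_zpow_mul_coboundary (κ := κ) v hker
      hequiv' ht hne hgt hτ₀ hτ₀t (u := uY) (m := mY) rfl (pow_ne_zero 2 hz0) hz2L hz2j (by rw [huY]; exact hyk2)⟩⟩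
  let cMY : AddCommGroup.primaryComponent (FixedPoints.addSubgroup Hi P ⧸ D) 2 :=
    ⟨mMY, (AddCommGroup.mem_primaryComponent).mpr ⟨k + 1, nsmul_mk_eq_zero_of_pow_eq_zpow_mul_coboundary (κ := κ) v hker
      hequiv' ht hne hgt hτ₀ hτ₀t (u := uMY) (m := mMY) rfl (pow_ne_zero 2 hz0) hz2L hz2j (by rw [huMY]; exact hmyk2)⟩⟩
  let cM1 : AddCommGroup.primaryComponent (FixedPoints.addSubgroup Hi P ⧸ D) 2 :=
    ⟨mM1, (AddCommGroup.mem_primaryComponent).mpr ⟨1, nsmul_mk_eq_zero_of_pow_eq_zpow_mul_coboundary (κ := κ) v hker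
      hequiv' ht hne hgt hτ₀ hτ₀t (u := uM1) (m := mM1) rfl one_ne_zero h1L h1j (by rw [huM1]; exact hone1)⟩⟩
  -- equal classes ⟹ quotient in `B` ⟹ even exponent / `-1 ∈ B`
  have hB : ∀ {u₁ u₂ : (AlgebraicClosure (v.adicCompletion ℚ))ˣ} {m₁ m₂ : FixedPoints.addSubgroup Hi P},
      (m₁ : P) = Ψ (Additive.ofMul u₁) → (m₂ : P) = Ψ (Additive.ofMul u₂) →
      (m₁ : FixedPoints.addSubgroup Hi P ⧸ D) = m₂ →
      ∃ (j' : ℤ) (w : AlgebraicClosure (v.adicCompletion ℚ)), w ≠ 0 ∧ (∀ h ∈ Hi, h • t = t → h • w = w) ∧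
        (∃ jw : ℤ, τ₀ • w * w = Q ^ jw) ∧
        (u₁ : AlgebraicClosure (v.adicCompletion ℚ)) / u₂ = Q ^ j' * (g • w / w) := fun hm₁ hm₂ heq ↦
    exists_div_eq_zpow_mul_coboundary_of_mk_eq_mk (κ := κ) v hsurj hker hequiv' hQfix hQ0 hQtor hne hgt hτ₀ hτ₀t hm₁ hm₂ heq
  have hodd : ∀ {x w : AlgebraicClosure (v.adicCompletion ℚ)} {b j' jw : ℤ}, Odd b → τ₀ • x * x = Q ^ b → w ≠ 0 →
      (∀ h ∈ Hi, h • t = t → h • w = w) → τ₀ • w * w = Q ^ jw → x = Q ^ j' * (g • w / w) → False :=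
    fun {x w b j' jw} hb hxb hw0 hwL hwj hx ↦ by
      have h2 := eq_two_mul_of_eq_zpow_mul_coboundary (κ := κ) v ht hgt hτ₀ hτ₀t hQfix hQ0 hQtor hxb hw0 hwL hwj hx
      exact (Int.not_even_iff_odd.mpr hb) ⟨j', by rw [h2]; ring⟩
  have hyinv : τ₀ • y⁻¹ * y⁻¹ = Q ^ (-a) := by rw [smul_inv'', ← _root_.mul_inv, hya, zpow_neg]
  have h0 : ((0 : FixedPoints.addSubgroup Hi P) : P) = Ψ (Additive.ofMul 1) := by rw [ofMul_one, map_zero]; rfl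
  have c0val : ((0 : AddCommGroup.primaryComponent (FixedPoints.addSubgroup Hi P ⧸ D) 2) :
      FixedPoints.addSubgroup Hi P ⧸ D) = ((0 : FixedPoints.addSubgroup Hi P) : FixedPoints.addSubgroup Hi P ⧸ D) := by
    simp
  -- the six inequalities
  have hY0 : cY ≠ 0 := fun h ↦ by
    obtain ⟨j', w, hw0, hwL, ⟨jw, hwj⟩, hrel⟩ := hB (u₁ := uY) (u₂ := 1) (m₁ := mY) (m₂ := 0) rfl h0
      ((congrArg Subtype.val h).trans c0val)
    rw [huY, Units.val_one, div_one] at hrel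
    exact hodd ha hya hw0 hwL hwj hrel
  have hMY0 : cMY ≠ 0 := fun h ↦ by
    obtain ⟨j', w, hw0, hwL, ⟨jw, hwj⟩, hrel⟩ := hB (u₁ := uMY) (u₂ := 1) (m₁ := mMY) (m₂ := 0) rfl h0
      ((congrArg Subtype.val h).trans c0val)
    rw [huMY, Units.val_one, div_one] at hrel
    exact hodd ha hmya hw0 hwL hwj hrel
  have hM10 : cM1 ≠ 0 := fun h ↦ by
    obtain ⟨j', w, hw0, hwL, ⟨jw, hwj⟩, hrel⟩ := hB (u₁ := uM1) (u₂ := 1) (m₁ := mM1) (m₂ := 0) rfl h0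
      ((congrArg Subtype.val h).trans c0val)
    rw [huM1, Units.val_one, div_one] at hrel
    exact hneg w jw j' hw0 hwL hwj hrel
  have hYM1 : cY ≠ cM1 := fun h ↦ by
    obtain ⟨j', w, hw0, hwL, ⟨jw, hwj⟩, hrel⟩ := hB (u₁ := uY) (u₂ := uM1) (m₁ := mY) (m₂ := mM1) rfl rfl
      (congrArg Subtype.val h)
    rw [huY, huM1, div_neg, div_one] at hrel
    exact hodd ha hmya hw0 hwL hwj hrel
  have hYMY : cY ≠ cMY := fun h ↦ by
    obtain ⟨j', w, hw0, hwL, ⟨jw, hwj⟩, hrel⟩ := hB (u₁ := uY) (u₂ := uMY) (m₁ := mY) (m₂ := mMY) rfl rfl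
      (congrArg Subtype.val h)
    rw [huY, huMY, div_neg, div_self hy0] at hrel
    exact hneg w jw j' hw0 hwL hwj hrel
  have hM1MY : cM1 ≠ cMY := fun h ↦ by
    obtain ⟨j', w, hw0, hwL, ⟨jw, hwj⟩, hrel⟩ := hB (u₁ := uM1) (u₂ := uMY) (m₁ := mM1) (m₂ := mMY) rfl rfl
      (congrArg Subtype.val h)
    rw [huM1, huMY, neg_div_neg_eq, one_div] at hrel
    exact hodd ha.neg hyinv hw0 hwL hwj hrel
  -- four distinct elements
  letI := Fintype.ofFinite (AddCommGroup.primaryComponent (FixedPoints.addSubgroup Hi P ⧸ D) 2)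
  have h4 : ({0, cM1, cY, cMY} : Finset (AddCommGroup.primaryComponent (FixedPoints.addSubgroup Hi P ⧸ D) 2)).card = 4 := by
    rw [Finset.card_insert_of_notMem (by simp [hM10.symm, hY0.symm, hMY0.symm]),
      Finset.card_insert_of_notMem (by simp [hYM1.symm, hM1MY]), Finset.card_pair hYMY]
  have hle := Finset.card_le_univ ({0, cM1, cY, cMY} :
    Finset (AddCommGroup.primaryComponent (FixedPoints.addSubgroup Hi P ⧸ D) 2))
  rw [h4, ← Nat.card_eq_fintype_card] at hle
  exact hle

end Count

end Summit.BirchSwinnertonDyer.BirchSwinnertonDyer.Theorems.MultTowerNS2LayerZero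

end
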